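import Mathlib.Algebra.MvPolynomial.NoZeroDivisors
import Literature.Computability.Complexity.MatchingSymmetry
import HarnessLib

/-!
# BBCHPRRWZ Lemma 4.8: degree increase along `K_n ⊂ K_{n+2}`

Braun–Brown-Cohen–Huq–Pokutta–Raghavendra–Roy–Weitz–Zink, *The matching problem has no small
symmetric SDP*, Math. Program. 165 (2017), Lemma 4.8: "If `L` is a polynomial with
`L ≅_{(𝒫_{n-2}, d)} 0` for some `d`, and `a, b` are the two additional vertices in `K_n`, then
`L x_{ab} ≅_{(𝒫_n, d+1)} 0`."  Proof (verbatim): it suffices to treat generators; Boolean and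
disjointness generators of `K_{n-2}` are generators of `K_n`; for a vertex equation
`L = Σ_{u ∈ K_{n-2}} x_{uv} - 1`,
`L x_{ab} = (Σ_{u ∈ K_n} x_{uv} - 1) x_{ab} - x_{av} x_{ab} - x_{bv} x_{ab} ≅_{d+1} 0`.

Here `K_n ⊂ K_{n+2}` is an arbitrary vertex embedding `ι` missing exactly `a, b`
(`polyEmbed ι`, `MatchingSymmetry.lean`), derivations are `HasDerivationOfDegree`
(`MatchingDerivations.lean`), and the statement proved (`degreeIncrease`) is the cell's typed
`DegreeIncrease` (HOME/pnp-psdrank-p2/Sketch-v2.lean §2c) WITH THE SIDE CONDITION `n ≠ 1`, which is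
necessary: for `K_1 ⊂ K_3` the constant `L = 1` is derivable in degree `0` from `𝒫_1 = {-1}` but
`x_{ab}` is not derivable from `𝒫_3` in degree `1` (the printed lemma is only used for even `n`).

## References

* G. Braun et al., *The matching problem has no small symmetric SDP*, Math. Program. 165 (2017)
  643–662, Lemma 4.8 (arXiv:1504.00703, p. 9). [BraunEtAl2016]
-/

noncomputable section

open MvPolynomial Finset

namespace Literature.Computability.Complexity

/-! ### Calculus of derivations -/

section Deriv

variable {ι σ K : Type*} [CommRing K] [Fintype ι] {S : ι → MvPolynomial σ K} {D : ℕ}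
  {F G : MvPolynomial σ K}

/-- `0` is derivable. [cite: BraunEtAl2016, §4.2 (p. 7)] -/
theorem HasDerivationOfDegree.zero : HasDerivationOfDegree S 0 D :=
  ⟨0, fun e => by simp, by simp⟩

/-- Sums of derivations. [cite: BraunEtAl2016, §4.2 (p. 7)] -/
theorem HasDerivationOfDegree.add (hF : HasDerivationOfDegree S F D) (hG : HasDerivationOfDegree S G D) :
    HasDerivationOfDegree S (F + G) D := by
  rw [← isCong_zero_left_iff] at hF hG ⊢
  simpa using hF.add hG

/-- Negation. [cite: BraunEtAl2016, §4.2 (p. 7)] -/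
theorem HasDerivationOfDegree.neg (hF : HasDerivationOfDegree S F D) : HasDerivationOfDegree S (-F) D := by
  rw [← isCong_zero_left_iff] at hF ⊢
  simpa using hF.neg

/-- Differences. [cite: BraunEtAl2016, §4.2 (p. 7)] -/
theorem HasDerivationOfDegree.sub (hF : HasDerivationOfDegree S F D) (hG : HasDerivationOfDegree S G D) :
    HasDerivationOfDegree S (F - G) D := by
  rw [sub_eq_add_neg]; exact hF.add hG.neg

/-- Finite sums. [cite: BraunEtAl2016, §4.2 (p. 7)] -/
theorem HasDerivationOfDegree.sum {κ : Type*} {s : Finset κ} {F : κ → MvPolynomial σ K}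
    (h : ∀ k ∈ s, HasDerivationOfDegree S (F k) D) : HasDerivationOfDegree S (∑ k ∈ s, F k) D := by
  classical
  induction s using Finset.induction_on with
  | empty => simpa using (HasDerivationOfDegree.zero : HasDerivationOfDegree S 0 D)
  | insert a s ha ih =>
    rw [sum_insert ha]
    exact (h a (mem_insert_self a s)).add (ih fun k hk => h k (mem_insert_of_mem hk))

/-- Monotonicity. [cite: BraunEtAl2016, §4.2 (p. 7)] -/
theorem HasDerivationOfDegree.mono {D' : ℕ} (hF : HasDerivationOfDegree S F D) (h : D ≤ D') :
    HasDerivationOfDegree S F D' := by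
  obtain ⟨g, hg, hsum⟩ := hF
  exact ⟨g, fun e => (hg e).trans h, hsum⟩

/-- A multiple of one generator is derivable in its own degree. [cite: BraunEtAl2016, §4.2 (p. 7)] -/
theorem hasDerivationOfDegree_mul_generator [DecidableEq ι] (q : MvPolynomial σ K) (k : ι)
    (h : (q * S k).totalDegree ≤ D) : HasDerivationOfDegree S (q * S k) D := by
  refine ⟨fun k' => if k' = k then q else 0, fun k' => ?_, ?_⟩
  · dsimp only
    by_cases hk : k' = k
    · subst hk; rw [if_pos rfl]; exact h
    · rw [if_neg hk, zero_mul, totalDegree_zero]; exact Nat.zero_le _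
  · dsimp only
    rw [Finset.sum_eq_single k (fun k' _ hk' => by rw [if_neg hk', zero_mul])
      (fun h => absurd (mem_univ k) h), if_pos rfl]

end Deriv

/-! ### The embedding `K_n ⊂ K_{n+2}` -/

namespace Mod2

variable {n : ℕ} {ι : Fin n ↪ Fin (n + 2)} {a b : Fin (n + 2)}

/-- The new edge `{a, b}`. [cite: BraunEtAl2016, Lemma 4.8 (p. 9)] -/
def newEdge (a b : Fin (n + 2)) (hab : a ≠ b) : KnEdge (n + 2) :=
  ⟨s(a, b), fun h => hab (Sym2.mk_isDiag_iff.1 h)⟩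

/-- An old vertex joined to a new vertex. [cite: BraunEtAl2016, Lemma 4.8 (p. 9, "x_{av}")] -/
def joinEdge (ι : Fin n ↪ Fin (n + 2)) (a : Fin (n + 2)) (ha : a ∉ Set.range ι) (v : Fin n) :
    KnEdge (n + 2) :=
  ⟨s(ι v, a), fun h => ha ⟨v, Sym2.mk_isDiag_iff.1 h⟩⟩

section Vertex

variable (hab : a ≠ b) (hrange : ∀ v : Fin (n + 2), v ∉ Set.range ι ↔ v = a ∨ v = b)
include hrange

/-- `a` is new. [cite: BraunEtAl2016, Lemma 4.8 (p. 9)] -/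
theorem not_mem_range_a : a ∉ Set.range ι := (hrange a).2 (Or.inl rfl)

/-- `b` is new. [cite: BraunEtAl2016, Lemma 4.8 (p. 9)] -/
theorem not_mem_range_b : b ∉ Set.range ι := (hrange b).2 (Or.inr rfl)

/-- **The edges of `K_{n+2}` at an old vertex `ι v`**: the images of the edges of `K_n` at `v`
together with `{ιv, a}` and `{ιv, b}`. [cite: BraunEtAl2016, Lemma 4.8 (p. 9, "Σ_{u ∈ K_n} x_{uv} = Σ_{u ∈ K_{n-2}} x_{uv} + x_{av} + x_{bv}")] -/
theorem filter_mem_embed (v : Fin n) :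
    (univ.filter fun e' : KnEdge (n + 2) => ι v ∈ (e' : Sym2 (Fin (n + 2)))) =
      insert (joinEdge ι a (not_mem_range_a hrange) v)
        (insert (joinEdge ι b (not_mem_range_b hrange) v)
          ((univ.filter fun e : KnEdge n => v ∈ (e : Sym2 (Fin n))).image (edgeMap ι ι.injective))) := by
  classical
  ext e'
  simp only [mem_filter, mem_univ, true_and, mem_insert, mem_image]
  constructor
  · intro hv
    obtain ⟨e', he'⟩ := e'
    induction e' using Sym2.ind with
    | _ x y =>
      -- `ι v ∈ {x, y}`: say `x = ι v` (up to swapping)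
      have key : ∀ x y : Fin (n + 2), (hxy : ¬ (s(x, y) : Sym2 (Fin (n + 2))).IsDiag) → x = ι v →
          (⟨s(x, y), hxy⟩ : KnEdge (n + 2)) = joinEdge ι a (not_mem_range_a hrange) v ∨
          (⟨s(x, y), hxy⟩ : KnEdge (n + 2)) = joinEdge ι b (not_mem_range_b hrange) v ∨
          ∃ e : KnEdge n, v ∈ (e : Sym2 (Fin n)) ∧ edgeMap ι ι.injective e = ⟨s(x, y), hxy⟩ := by
        intro x y hxy hx
        subst hx
        by_cases hy : y ∈ Set.range ι
        · obtain ⟨u, rfl⟩ := hy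
          have hvu : v ≠ u := fun h => hxy (by rw [Sym2.mk_isDiag_iff, h])
          refine Or.inr (Or.inr ⟨⟨s(v, u), fun h => hvu (Sym2.mk_isDiag_iff.1 h)⟩,
            Sym2.mem_mk_left _ _, Subtype.ext ?_⟩)
          simp [edgeMap]
        · rcases (hrange y).1 hy with rfl | rfl
          · exact Or.inl (Subtype.ext rfl)
          · exact Or.inr (Or.inl (Subtype.ext rfl))
      rcases Sym2.mem_iff.1 hv with h | h
      · exact key x y he' h.symm
      · have hyx : (⟨s(x, y), he'⟩ : KnEdge (n + 2)) = ⟨s(y, x), by rwa [Sym2.eq_swap]⟩ :=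
          Subtype.ext Sym2.eq_swap
        rw [hyx]
        exact key y x _ h.symm
  · rintro (rfl | rfl | ⟨e, he, rfl⟩)
    · exact Sym2.mem_mk_left _ _
    · exact Sym2.mem_mk_left _ _
    · simp only [coe_edgeMap, Sym2.mem_map]
      exact ⟨v, he, rfl⟩

/-- **The vertex equation of `K_n` inside `K_{n+2}`**:
`polyEmbed ι (Σ_{e ∋ v} x_e - 1) = (Σ_{e' ∋ ιv} x_{e'} - 1) - x_{ιv,a} - x_{ιv,b}`.
[cite: BraunEtAl2016, Lemma 4.8 (p. 9)] -/
theorem polyEmbed_system_vertex (hab : a ≠ b) (v : Fin n) :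
    polyEmbed ι (system n (Sum.inr (Sum.inr v))) =
      system (n + 2) (Sum.inr (Sum.inr (ι v))) - X (joinEdge ι a (not_mem_range_a hrange) v)
        - X (joinEdge ι b (not_mem_range_b hrange) v) := by
  classical
  rw [system_vertex, system_vertex, polyEmbed, map_sub, map_one, map_sum,
    filter_mem_embed hrange v]
  simp_rw [rename_X]
  have hab' : joinEdge ι a (not_mem_range_a hrange) v ≠ joinEdge ι b (not_mem_range_b hrange) v := by
    intro h
    have := congrArg (fun e : KnEdge (n + 2) => (e : Sym2 (Fin (n + 2)))) h
    exact hab (Sym2.congr_right.1 this)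
  have hnot : ∀ {c : Fin (n + 2)} (hc : c ∉ Set.range ι),
      joinEdge ι c hc v ∉ (univ.filter fun e : KnEdge n => v ∈ (e : Sym2 (Fin n))).image
        (edgeMap ι ι.injective) := by
    intro c hc h
    obtain ⟨e, -, he⟩ := mem_image.1 h
    have hmem : c ∈ ((edgeMap ι ι.injective e : KnEdge (n + 2)) : Sym2 (Fin (n + 2))) := by
      rw [he]; exact Sym2.mem_mk_right _ _
    rw [coe_edgeMap, Sym2.mem_map] at hmem
    obtain ⟨w, -, hw⟩ := hmem
    exact hc ⟨w, hw⟩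
  have hja : joinEdge ι a (not_mem_range_a hrange) v ∉
      insert (joinEdge ι b (not_mem_range_b hrange) v)
        ((univ.filter fun e : KnEdge n => v ∈ (e : Sym2 (Fin n))).image (edgeMap ι ι.injective)) := by
    rw [mem_insert, not_or]
    exact ⟨hab', hnot _⟩
  rw [sum_insert hja, sum_insert (hnot _), sum_image fun e _ e' _ h => edgeMap_injective _ _ h]
  ring

end Vertex

/-! ### Lemma 4.8 -/

/-- A vertex equation of `K_n`, `n ≥ 2`, has total degree exactly `1`. [cite: BraunEtAl2016, §4.2 (p. 7)] -/
theorem totalDegree_system_vertex (hn : 2 ≤ n) (v : Fin n) :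
    (system n (Sum.inr (Sum.inr v))).totalDegree = 1 := by
  classical
  apply le_antisymm
  · rw [system_vertex]
    refine (totalDegree_sub _ _).trans (max_le ?_ (by simp))
    exact (totalDegree_finsetSum _ _).trans (Finset.sup_le fun e _ => (totalDegree_X e).le)
  · -- the monomial `x_{vw}` occurs
    obtain ⟨w, hw⟩ : ∃ w : Fin n, w ≠ v := by
      by_cases h : v = ⟨0, by omega⟩
      · exact ⟨⟨1, by omega⟩, fun h' => by rw [h] at h'; simp [Fin.ext_iff] at h'⟩
      · exact ⟨⟨0, by omega⟩, fun h' => h h'.symm⟩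
    let e : KnEdge n := ⟨s(v, w), fun h => hw (Sym2.mk_isDiag_iff.1 h).symm⟩
    have hcoeff : coeff (Finsupp.single e 1) (system n (Sum.inr (Sum.inr v))) = 1 := by
      rw [system_vertex, coeff_sub, coeff_sum, coeff_one, if_neg (Finsupp.single_ne_zero.2 one_ne_zero).symm,
        sub_zero]
      simp_rw [coeff_X]
      rw [Finset.sum_eq_single e]
      · rw [if_pos rfl]
      · intro f _ hfe
        rw [if_neg]
        exact fun h => hfe (Finsupp.single_left_injective one_ne_zero h)
      · intro h
        exact absurd (mem_filter.2 ⟨mem_univ e, Sym2.mem_mk_left v w⟩ :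
          e ∈ univ.filter fun e : KnEdge n => v ∈ (e : Sym2 (Fin n))) h
    have hmem : Finsupp.single e 1 ∈ (system n (Sum.inr (Sum.inr v))).support := by
      rw [mem_support_iff, hcoeff]; exact one_ne_zero
    have := le_totalDegree hmem
    rwa [Finsupp.sum_single_index rfl] at this

/-- **BBCHPRRWZ Lemma 4.8 (degree increase).** Let `ι : K_n ↪ K_{n+2}` miss exactly the two
vertices `a ≠ b`, and `n ≠ 1`. If `L` is derivable from `𝒫_n` in degree `d` then `ι(L)·x_{ab}` is
derivable from `𝒫_{n+2}` in degree `d + 1`. (For `n = 1` the statement fails: `1` is derivable from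
`𝒫_1 = {-1}` in degree `0` but `x_{ab}` is not derivable from `𝒫_3` in degree `1`; the paper uses
even `n` only.) [cite: BraunEtAl2016, Lemma 4.8 (p. 9)] -/
theorem degreeIncrease (hn : n ≠ 1) (ι : Fin n ↪ Fin (n + 2)) (a b : Fin (n + 2)) (hab : a ≠ b)
    (hrange : ∀ v : Fin (n + 2), v ∉ Set.range ι ↔ v = a ∨ v = b)
    (L : MvPolynomial (KnEdge n) ℝ) (d : ℕ) (hL : HasDerivationOfDegree (system n) L d) :
    HasDerivationOfDegree (system (n + 2)) (polyEmbed ι L * X (newEdge a b hab)) (d + 1) := by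
  classical
  obtain ⟨g, hg, rfl⟩ := hL
  rw [map_sum, sum_mul]
  refine HasDerivationOfDegree.sum fun k _ => ?_
  rw [map_mul]
  -- degree bookkeeping: `deg (ι(g_k · S_k) · x_ab) ≤ d + 1`
  have hdeg : (polyEmbed ι (g k) * polyEmbed ι (system n k) * X (newEdge a b hab)).totalDegree ≤ d + 1 := by
    rw [← map_mul]
    refine (totalDegree_mul _ _).trans ?_
    rw [totalDegree_X]
    exact Nat.add_le_add_right ((totalDegree_rename_le _ _).trans (hg k)) 1
  rcases k with e | p | v
  · -- Boolean axiom ↦ Boolean axiom of the image edge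
    have himg : polyEmbed ι (system n (Sum.inl e)) =
        system (n + 2) (Sum.inl (edgeMap ι ι.injective e)) := by
      rw [system_edge, system_edge, polyEmbed, map_sub, map_pow, rename_X]
    have : polyEmbed ι (g (Sum.inl e)) * polyEmbed ι (system n (Sum.inl e)) * X (newEdge a b hab) =
        (polyEmbed ι (g (Sum.inl e)) * X (newEdge a b hab)) *
          system (n + 2) (Sum.inl (edgeMap ι ι.injective e)) := by
      rw [himg]; ring
    rw [this]
    refine hasDerivationOfDegree_mul_generator _ _ ?_
    rw [← this]; exact hdeg
  · -- disjointness axiom ↦ disjointness axiom of the image edges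
    obtain ⟨⟨e, f⟩, hne, i, hie, hif⟩ := p
    let p' : {p : KnEdge (n + 2) × KnEdge (n + 2) //
        p.1 ≠ p.2 ∧ ∃ i : Fin (n + 2), i ∈ (p.1 : Sym2 (Fin (n + 2))) ∧ i ∈ (p.2 : Sym2 (Fin (n + 2)))} :=
      ⟨(edgeMap ι ι.injective e, edgeMap ι ι.injective f),
        fun h => hne (edgeMap_injective _ ι.injective h),
        ι i, by simp only [coe_edgeMap, Sym2.mem_map]; exact ⟨i, hie, rfl⟩,
        by simp only [coe_edgeMap, Sym2.mem_map]; exact ⟨i, hif, rfl⟩⟩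
    have himg : polyEmbed ι (system n (Sum.inr (Sum.inl ⟨(e, f), hne, i, hie, hif⟩))) =
        system (n + 2) (Sum.inr (Sum.inl p')) := by
      rw [system_pair, system_pair, polyEmbed, map_mul, rename_X, rename_X]
    have : polyEmbed ι (g (Sum.inr (Sum.inl ⟨(e, f), hne, i, hie, hif⟩))) *
          polyEmbed ι (system n (Sum.inr (Sum.inl ⟨(e, f), hne, i, hie, hif⟩))) * X (newEdge a b hab) =
        (polyEmbed ι (g (Sum.inr (Sum.inl ⟨(e, f), hne, i, hie, hif⟩))) * X (newEdge a b hab)) *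
          system (n + 2) (Sum.inr (Sum.inl p')) := by
      rw [himg]; ring
    rw [this]
    refine hasDerivationOfDegree_mul_generator _ _ ?_
    rw [← this]; exact hdeg
  · -- vertex equation: `ι(S_v) x_ab = S'_{ιv} x_ab - x_{ιv a} x_ab - x_{ιv b} x_ab`
    have hn2 : 2 ≤ n := by
      have := v.isLt; omega
    -- degree of `g_v` is at most `d - 1` (unless `g_v = 0`)
    by_cases hg0 : g (Sum.inr (Sum.inr v)) = 0
    · rw [hg0, map_zero, zero_mul, zero_mul]; exact HasDerivationOfDegree.zero
    set G := polyEmbed ι (g (Sum.inr (Sum.inr v))) with hG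
    have hdegG : G.totalDegree + 2 ≤ d + 1 := by
      have h1 := hg (Sum.inr (Sum.inr v))
      rw [totalDegree_mul_of_isDomain hg0 (fun h => by
        have := totalDegree_system_vertex hn2 v; rw [h, totalDegree_zero] at this; exact zero_ne_one this),
        totalDegree_system_vertex hn2 v] at h1
      have h2 : G.totalDegree ≤ (g (Sum.inr (Sum.inr v))).totalDegree := totalDegree_rename_le _ _
      omega
    rw [polyEmbed_system_vertex hrange hab v]
    -- the two correction terms are disjointness axioms at `a` and at `b`
    have hva : joinEdge ι a (not_mem_range_a hrange) v ≠ newEdge a b hab := by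
      intro h
      have := congrArg (fun e : KnEdge (n + 2) => (e : Sym2 (Fin (n + 2)))) h
      simp only [joinEdge, newEdge] at this
      -- `s(ι v, a) = s(a, b)` forces `ι v = b`
      rcases Sym2.eq_iff.1 this with ⟨h1, -⟩ | ⟨h1, -⟩
      · exact (not_mem_range_a hrange) ⟨v, h1⟩
      · exact (not_mem_range_b hrange) ⟨v, h1⟩
    have hvb : joinEdge ι b (not_mem_range_b hrange) v ≠ newEdge a b hab := by
      intro h
      have := congrArg (fun e : KnEdge (n + 2) => (e : Sym2 (Fin (n + 2)))) h
      simp only [joinEdge, newEdge] at this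
      rcases Sym2.eq_iff.1 this with ⟨h1, -⟩ | ⟨h1, -⟩
      · exact (not_mem_range_a hrange) ⟨v, h1⟩
      · exact (not_mem_range_b hrange) ⟨v, h1⟩
    let pa : {p : KnEdge (n + 2) × KnEdge (n + 2) //
        p.1 ≠ p.2 ∧ ∃ i : Fin (n + 2), i ∈ (p.1 : Sym2 (Fin (n + 2))) ∧ i ∈ (p.2 : Sym2 (Fin (n + 2)))} :=
      ⟨(joinEdge ι a (not_mem_range_a hrange) v, newEdge a b hab), hva, a,
        Sym2.mem_mk_right _ _, Sym2.mem_mk_left _ _⟩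
    let pb : {p : KnEdge (n + 2) × KnEdge (n + 2) //
        p.1 ≠ p.2 ∧ ∃ i : Fin (n + 2), i ∈ (p.1 : Sym2 (Fin (n + 2))) ∧ i ∈ (p.2 : Sym2 (Fin (n + 2)))} :=
      ⟨(joinEdge ι b (not_mem_range_b hrange) v, newEdge a b hab), hvb, b,
        Sym2.mem_mk_right _ _, Sym2.mem_mk_right _ _⟩
    have hsplit : G * (system (n + 2) (Sum.inr (Sum.inr (ι v))) -
          X (joinEdge ι a (not_mem_range_a hrange) v) - X (joinEdge ι b (not_mem_range_b hrange) v)) *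
          X (newEdge a b hab) =
        (G * X (newEdge a b hab)) * system (n + 2) (Sum.inr (Sum.inr (ι v))) -
          G * system (n + 2) (Sum.inr (Sum.inl pa)) - G * system (n + 2) (Sum.inr (Sum.inl pb)) := by
      rw [system_pair, system_pair]; ring
    rw [hsplit]
    refine ((hasDerivationOfDegree_mul_generator _ _ ?_).sub
      (hasDerivationOfDegree_mul_generator _ _ ?_)).sub (hasDerivationOfDegree_mul_generator _ _ ?_)
    · refine (totalDegree_mul _ _).trans ?_
      refine (Nat.add_le_add (totalDegree_mul _ _) (le_of_eq (totalDegree_system_vertex (by omega) (ι v)))).trans ?_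
      rw [totalDegree_X]; omega
    · refine (totalDegree_mul _ _).trans ?_
      rw [system_pair]
      refine (Nat.add_le_add_left ((totalDegree_mul _ _).trans (by rw [totalDegree_X, totalDegree_X])) _).trans ?_
      omega
    · refine (totalDegree_mul _ _).trans ?_
      rw [system_pair]
      refine (Nat.add_le_add_left ((totalDegree_mul _ _).trans (by rw [totalDegree_X, totalDegree_X])) _).trans ?_
      omega

end Mod2

end Literature.Computability.Complexity
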